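import Literature.AlgebraicGeometry.Resolution.KnafKuhlmann2009HenselianRationality
import Literature.AlgebraicGeometry.Resolution.Henselization
import Literature.AlgebraicGeometry.Resolution.SubfieldTransport
import Mathlib.FieldTheory.IsAlgClosed.AlgebraicClosure
import HarnessLib

/-!
# Henselian rationality (Kuhlmann 2019, Thm. 1.3) and henselian elements (Kuhlmann–Novacoski 2014, Thm. 1.2)

Topic: `Literature/AlgebraicGeometry/Resolution`. First layer of the decomposition of the named
fact `KnafKuhlmann2009_Thm38_sepClosed` (`KnafKuhlmann2009HenselianRationality.lean`: Knaf–Kuhlmann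
2009, Thm. 3.8 for a separably closed ground field, with the conclusion "`(F,P)` lies in the
henselization `(K(x)^h, P^h)`" rendered in Hensel-root form), along the printed sources of its
two halves:

1. Thm. 3.8 itself is F.-V. Kuhlmann's HENSELIAN RATIONALITY, [KK09] p. 14: "For the proof of
   the theorem in this case see [K8]" = Kuhlmann 2019, Thm. 1.3 (p. 2 of arXiv:1701.05508):
   "Let `(K, v)` be a separably tame field and `(F|K, v)` an immediate function field, with
   `F|K` a separable extension. If its transcendence degree over `K` is `1`, then `(F|K, v)` is
   henselian rational." — "henselian rational" (p. 1): "admits a transcendence basis `T ⊂ F`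
   such that `F` lies in the henselization of the rational function field `K(T)`". Its proof
   is §5 of the paper: Prop. 5.2 (separable-algebraically closed `K` of rank `1`: Lemma 5.1 —
   Ostrowski's lemma and `p`-groups make `F.K(x)^h | K(x)^h` a tower of Galois extensions of
   degree `p` —, the Artin–Schreier / Kummer normal forms of §4, Props. 4.8, 4.9, and
   Kuhlmann–Vlahu, *The relative approximation degree*, Thm. 11.1), Prop. 5.6 (finite rank:
   composite places, Lemma 5.5, and the Generalized Stability Theorem of *Elimination of
   ramification I*), Prop. 5.7 (arbitrary rank). We vendor the statement for `K` separably
   closed — the case `(K^{sep}, 𝒫)` in which [KK09] §4.1 uses Thm. 3.8; a separably closed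
   valued field is separably tame ([KK09] §2.3: "separably tame if it is henselian and satisfies
   `K^{sep} = K^r`") — with the henselization `henselization V E ⊆ Ω` of `Henselization.lean`
   (the decomposition field of `V ∩ E^{sep}`, for `Ω` algebraically closed):
   `Kuhlmann2019_Thm13_sepClosed`.

2. The passage from "`F ⊆ K(x)^h`, `F|K(x)` finite" to the Hensel-root form is
   Kuhlmann–Novacoski 2014, Thm. 1.2 (p. 3 of arXiv:1311.6155; "proved by the first author in
   [FVKC] for the valuative case"), quoted for exactly this purpose in Kuhlmann 2019, p. 14
   ("[19, Theorem 1.2] shows that it is generated by a henselian element `η ∈ F.K'`, that is,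
   the coefficients of its minimal polynomial `h` over `K'(T)` lie in the valuation ring of
   `K'(T)`, and `vh'(η) = 0`"): in the situation (1.1) — `A` an integrally closed local domain
   with quotient field `L`, `𝔐̃` a maximal ideal of the integral closure of `A` in `L^{sep}`,
   `F` a finite extension of `L` inside the inertia field of `L^{sep}|L` w.r.t. `𝔐̃`,
   `B = A^*_{𝔐̃ ∩ A^*}` — "there is `η ∈ B` such that `F = L(η)`, the (monic) minimal polynomial
   `h(X)` of `η` over `L` lies in `A[X]` and `η` and `h'(η)` are units in `B`." We vendor the
   valuative case (`A = O_L`, `B = O_F`) for `F` inside the HENSELIZATION `L^h ⊆ L^i` (the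
   decomposition field lies in the inertia field), which is the case needed here and avoids
   rendering the absolute inertia field: `KuhlmannNovacoski2014_Thm12`.

3. PROVED: `KnafKuhlmann2009_Thm38_sepClosed.of_henselianRational` — the two facts imply
   `KnafKuhlmann2009_Thm38_sepClosed` (for EVERY ambient field `Ω`, as that fact is stated):
   embed `Ω` into an algebraic closure `Ω̄`, extend `V` to `V̄` with `V̄ ∩ Ω = V`
   (`exists_valuationSubring_comap_eq`), transport the hypotheses (`SubfieldTransport.lean`),
   apply fact 1 to get `x` with `ι(F) ⊆ ι(K)(x)^h`, then fact 2 with `L = ι(K)(x)` (the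
   extension `ι(F)|L` is finite: finitely generated and, inside `L^h ⊆ L^{sep}`, algebraic),
   and pull `x`, `η` and the minimal polynomial back along `ι`.

So the trust base of `KnafKuhlmann2009_Thm38_sepClosed` — hence, along
`KnafKuhlmann2009HenselianRationalityProofs.lean`, of `KnafKuhlmann2009` — becomes
`{Kuhlmann2019_Thm13_sepClosed, KuhlmannNovacoski2014_Thm12}` (and `KnafKuhlmann2005_Thm34_etale`),
each a statement printed in its source. Fact 2 is provable with the means of
`Henselization.lean` (two pages of Galois and valuation theory in the source); fact 1 is a
theory ([K8] §§2–5 with its references) and is to be decomposed further.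

## Sources

* [K8] F.-V. Kuhlmann, *Elimination of ramification II: Henselian rationality*, Israel J.
  Math. 234 (2019) 927–958 = arXiv:1701.05508: p. 1 (henselian rational), Thm. 1.3 (p. 2),
  §5 (pp. 12–14: Lemma 5.1, Props. 5.2, 5.3, 5.6, 5.7), Prop. 6.1 (p. 14, the use of [19]).
* [KN14] F.-V. Kuhlmann, J. Novacoski, *Henselian elements*, J. Algebra 418 (2014) 44–65 =
  arXiv:1311.6155: situation (1.1) and Thm. 1.2 (p. 3), Def. 3.1 (p. 7: henselization and
  absolute inertia field w.r.t. `𝔐̃` as fixed fields).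
* [KK09] H. Knaf, F.-V. Kuhlmann, *Every place admits local uniformization in a finite
  extension of the function field*, Adv. Math. 221 (2009) = arXiv:math/0702856: §2.3 (p. 8),
  Thm. 3.8 (p. 13), p. 14.

## Rendering notes

As in `KnafKuhlmann2009HenselianRationality.lean`: `K ≤ F ≤ Ω` subfields of the valued field
`(Ω, V)`, here with `Ω` ALGEBRAICALLY CLOSED (so that `henselization V E` is the henselization
of `(E, V ∩ E)` inside `(Ω, V)`); "valued function field of transcendence degree `1`",
"separable", "immediate" exactly as there (`FGOver`, `SeparablyGeneratedOver`, a transcendental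
`x ∈ F` with `F` algebraic over `K(x)`, `IsImmediateOver`); `K(x) = Subfield.closure (K ∪ {x})`;
"`F|L` finite" = `FiniteOver`; "`η ∈ O_F` a unit" = `V.valuation η = 1`; "the monic minimal
polynomial `h` of `η` over `L` lies in `O_L[X]`" = `h` monic over `Ω` with coefficients in
`V ∩ L`, `h(η) = 0`, of least degree among the non-zero polynomials over `L` vanishing at `η`;
"`h'(η)` a unit in `O_F`" = `V.valuation (h'(η)) = 1`.
-/

noncomputable section

namespace Literature.AlgebraicGeometry.Resolution

universe u

open Polynomial

/-! ## The named facts -/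

/-- NAMED FACT — **Kuhlmann 2019, Thm. 1.3 (henselian rationality, transcendence degree `1`),
over a separably closed ground field.** "Let `(K, v)` be a separably tame field and `(F|K, v)`
an immediate function field, with `F|K` a separable extension. If its transcendence degree
over `K` is `1`, then `(F|K, v)` is henselian rational." with (p. 1) "An extension `(F|K, v)`
of valued fields will be called henselian rational if it admits a transcendence basis `T ⊂ F`
such that `F` lies in the henselization of the rational function field `K(T)`". This is
Knaf–Kuhlmann 2009, Thm. 3.8 ("there exists `x ∈ F` such that `(F,P)` lies in the
henselization `(K(x)^h,P^h)`"), whose proof [KK09] delegates to this paper. Vendored for `K`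
separably closed (a separably tame field: henselian, and `K^{sep} = K = K^r`; the case
`(K^{sep}, 𝒫)` of [KK09] §4.1), in the ambient rendering with `Ω` algebraically closed: for
`(F|K, V)` immediate, `F|K` finitely generated, separably generated, of transcendence degree
`1`, there is `x ∈ F` transcendental over `K` (a transcendence basis) with
`F ≤ K(x)^h = henselization V K(x)`. The valuation is automatically non-trivial on `K`
(an immediate `F ≠ K` forces it), as the source assumes throughout. Proof: [K8] §5
(Props. 5.2, 5.6, 5.7). Users take `(h : Kuhlmann2019_Thm13_sepClosed)`.
[cite: Kuhlmann2019, Thm. 1.3] -/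
def Kuhlmann2019_Thm13_sepClosed : Prop :=
  ∀ (Ω : Type u) [Field Ω] [IsAlgClosed Ω] (V : ValuationSubring Ω) (K F : Subfield Ω),
    IsSepClosed K → K ≤ F → FGOver K F → SeparablyGeneratedOver K F →
    (∃ x ∈ F, Transcendental K x ∧
      ∀ z ∈ F, IsAlgebraic (IntermediateField.adjoin K ({x} : Set Ω)) z) →
    IsImmediateOver V K F →
    ∃ x ∈ F, Transcendental K x ∧ F ≤ henselization V (Subfield.closure ((K : Set Ω) ∪ {x}))

/-- NAMED FACT — **Kuhlmann–Novacoski 2014, Thm. 1.2 (finite subextensions of the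
henselization are generated by a henselian element), valuative case.** Situation (1.1):
"`A` an integrally closed local domain with quotient field `L`, `𝔐̃` a maximal ideal of the
integral closure `I(A)` of `A` in `L^{sep}`, `F` a finite extension of `L` lying in the inertia
field of `L^{sep}|L` w.r.t. `𝔐̃`, `A^* = F ∩ I(A)` the integral closure of `A` in `F`,
`B = A^*_{𝔐̃ ∩ A^*}`." Thm. 1.2: "Assume the situation described in (1.1). Then there is
`η ∈ B` such that `F = L(η)`, the (monic) minimal polynomial `h(X)` of `η` over `L` lies in
`A[X]` and `η` and `h'(η)` are units in `B`. In particular, `η` is a henselian element over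
`A`." Vendored in the valuative case `A = O_L`, `B = O_F` ("proved by the first author in
[FVKC]") and for `F` inside the henselization `L^h` (Def. 3.1: the fixed field of
`{σ : σ(𝔐̃) = 𝔐̃}`, contained in the absolute inertia field, the fixed field of
`{σ : ∀ x ∈ I(A), x - σ(x) ∈ 𝔐̃}`), in the ambient rendering with `Ω` algebraically closed:
for subfields `L ≤ F ≤ henselization V L` with `F|L` finite there is `η ∈ F` with
`v(η) = 0`, `F = L(η)`, whose minimal polynomial over `L` — the monic `h` over `V ∩ L` of
least degree with `h(η) = 0` — satisfies `v(h'(η)) = 0` (values written multiplicatively: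
`= 1`). Users take `(h : KuhlmannNovacoski2014_Thm12)`. [cite: KuhlmannNovacoski2014, Thm. 1.2] -/
def KuhlmannNovacoski2014_Thm12 : Prop :=
  ∀ (Ω : Type u) [Field Ω] [IsAlgClosed Ω] (V : ValuationSubring Ω) (L F : Subfield Ω),
    L ≤ F → FiniteOver L F → F ≤ henselization V L →
    ∃ η ∈ F, V.valuation η = 1 ∧ Subfield.closure ((L : Set Ω) ∪ {η}) = F ∧
      ∃ h : Polynomial Ω, h.Monic ∧ (∀ k, h.coeff k ∈ V ∧ h.coeff k ∈ L) ∧ h.eval η = 0 ∧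
        (∀ q : Polynomial Ω, q ≠ 0 → (∀ k, q.coeff k ∈ L) → q.eval η = 0 →
          h.degree ≤ q.degree) ∧
        V.valuation ((derivative h).eval η) = 1

/-! ## API -/

/-- The data of `KuhlmannNovacoski2014_Thm12` without the minimality clause: a Hensel root
`η ∈ O_F` over `O_L` generating `F`. [folklore] -/
theorem KuhlmannNovacoski2014_Thm12.exists_henselRoot (hE : KuhlmannNovacoski2014_Thm12.{u})
    (Ω : Type u) [Field Ω] [IsAlgClosed Ω] (V : ValuationSubring Ω) (L F : Subfield Ω)
    (hLF : L ≤ F) (hfin : FiniteOver L F) (hh : F ≤ henselization V L) :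
    ∃ η ∈ F, η ∈ V ∧ Subfield.closure ((L : Set Ω) ∪ {η}) = F ∧
      ∃ h : Polynomial Ω, h.Monic ∧ (∀ k, h.coeff k ∈ V ∧ h.coeff k ∈ L) ∧ h.eval η = 0 ∧
        V.valuation ((derivative h).eval η) = 1 := by
  obtain ⟨η, hηF, hη1, hgen, h, hmon, hcoeff, hev, -, hder⟩ := hE Ω V L F hLF hfin hh
  exact ⟨η, hηF, (V.valuation_le_one_iff η).mp hη1.le, hgen, h, hmon, hcoeff, hev, hder⟩

/-! ## The assembly: Knaf–Kuhlmann 2009, Thm. 3.8 in Hensel-root form -/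

section Assembly

variable {Ω : Type u} [Field Ω]

/-- Inside the henselization every finitely generated extension of `L` is finite (elements of
`L^h ⊆ L^{sep}` are algebraic over `L`). [folklore] -/
theorem finiteOver_of_fgOver_of_le_henselization (V : ValuationSubring Ω) {L F : Subfield Ω}
    (hfg : FGOver L F) (hh : F ≤ henselization V L) : FiniteOver L F := by
  obtain ⟨s, hs⟩ := hfg
  refine ⟨s, fun y hy => ?_, hs⟩
  have hyF : y ∈ F := hs ▸ Subfield.subset_closure (Or.inr (Finset.mem_coe.mpr hy))
  exact (isSeparable_of_mem_henselization V L (hh hyF)).isIntegral.isAlgebraic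

/-- `F|K` finitely generated and `K ≤ L ≤ F` ⇒ `F|L` finitely generated. [folklore] -/
theorem FGOver.of_le {K L F : Subfield Ω} (hfg : FGOver K F) (hKL : K ≤ L) (hLF : L ≤ F) :
    FGOver L F := by
  obtain ⟨s, hs⟩ := hfg
  refine ⟨s, le_antisymm (Subfield.closure_le.mpr (Set.union_subset hLF fun y hy => ?_)) ?_⟩
  · exact hs ▸ Subfield.subset_closure (Or.inr hy)
  · conv_lhs => rw [← hs]
    exact Subfield.closure_mono (Set.union_subset_union_left _ hKL)

end Assembly

/-- **Knaf–Kuhlmann 2009, Thm. 3.8 (separably closed ground field, Hensel-root form) from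
henselian rationality (Kuhlmann 2019, Thm. 1.3) and henselian elements (Kuhlmann–Novacoski
2014, Thm. 1.2).** For an arbitrary ambient valued field `(Ω, V)`: embed `Ω` in an algebraic
closure `Ω̄` and extend `V` to `V̄` with `V̄ ∩ Ω = V`; the hypotheses pass to
`(ι(F)|ι(K), V̄)` (`SubfieldTransport.lean`); Thm. 1.3 gives `x ∈ F` transcendental over `K`
with `ι(F) ⊆ ι(K(x))^h`; `ι(F)|ι(K(x))` being finite, Thm. 1.2 gives a unit `η' = ι(η)` of
`O_{ι(F)}` generating `ι(F)` over `ι(K(x))` whose minimal polynomial `h = ι(f)` has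
coefficients in `O_{ι(K(x))}` and `h'(η')` a unit; pulling back, `F = K(x)(η)` with `η ∈ O_F`
a root of the monic `f` over `O_{K(x)}` and `f'(η) ∈ O_F^×`. This is the printed derivation
of [KK09] Thm. 3.8 in the form consumed on p. 14 (there via Lemma 3.7 (3) = [Ray] X Thm. 1;
here via [KN14], as in [K8] p. 14). [cite: KnafKuhlmann2009, Thm. 3.8] -/
theorem KnafKuhlmann2009_Thm38_sepClosed.of_henselianRational
    (hH : Kuhlmann2019_Thm13_sepClosed.{u}) (hE : KuhlmannNovacoski2014_Thm12.{u}) :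
    KnafKuhlmann2009_Thm38_sepClosed.{u} := by
  intro Ω _ V K F hK hKF hfg hsep h1 himm
  classical
  -- embed `Ω` in an algebraic closure `Ω'` and extend the valuation ring to `V'`
  let Ω' : Type u := AlgebraicClosure Ω
  let ι : Ω →+* Ω' := algebraMap Ω Ω'
  obtain ⟨V', hV'⟩ := exists_valuationSubring_comap_eq (Ω := Ω') V
  change V'.comap ι = V at hV'
  -- transport the hypotheses to `(ι(F)|ι(K), V')`
  haveI : IsSepClosed (K.map ι) := isSepClosed_map ι K
  have hKF' : K.map ι ≤ F.map ι := (Subfield.gc_map_comap ι).monotone_l hKF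
  have hfg' : FGOver (K.map ι) (F.map ι) := fgOver_map ι hfg
  have hsep' : SeparablyGeneratedOver (K.map ι) (F.map ι) := separablyGeneratedOver_map ι hsep
  have h1' := exists_transcendental_map ι h1
  have himm' : IsImmediateOver V' (K.map ι) (F.map ι) := isImmediateOver_map ι hV' himm
  -- henselian rationality: `ι(F) ≤ ι(K)(x')^h` for a transcendental `x' = ι x`
  obtain ⟨x', hx'F, hx'T, hFh⟩ :=
    hH Ω' V' (K.map ι) (F.map ι) inferInstance hKF' hfg' hsep' h1' himm'
  obtain ⟨x, hxF, rfl⟩ := Subfield.mem_map.mp hx'F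
  have hx : Transcendental K x := (transcendental_map_iff ι K x).mp hx'T
  -- `L = K(x)`, `ι(L) = ι(K)(ι x)`
  set L : Subfield Ω := Subfield.closure ((K : Set Ω) ∪ {x}) with hL
  have hL' : Subfield.closure ((K.map ι : Set Ω') ∪ {ι x}) = L.map ι := by
    rw [hL, map_closure_union, Set.image_singleton]
  rw [hL'] at hFh
  have hKL : K ≤ L := fun y hy => Subfield.subset_closure (Or.inl hy)
  have hLF : L ≤ F :=
    Subfield.closure_le.mpr (Set.union_subset hKF (Set.singleton_subset_iff.mpr hxF))
  have hLF' : L.map ι ≤ F.map ι := (Subfield.gc_map_comap ι).monotone_l hLF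
  -- `ι(F)|ι(L)` is finitely generated inside the henselization, hence finite
  have hfin' : FiniteOver (L.map ι) (F.map ι) :=
    finiteOver_of_fgOver_of_le_henselization V' (fgOver_map ι (hfg.of_le hKL hLF)) hFh
  -- henselian elements: a Hensel root `η' = ι η` generating `ι(F)` over `ι(L)`
  obtain ⟨η', hη'F, hη'1, hgen', h, hmon, hcoeff, hev, -, hder⟩ :=
    hE Ω' V' (L.map ι) (F.map ι) hLF' hfin' hFh
  obtain ⟨η, hηF, rfl⟩ := Subfield.mem_map.mp hη'F
  have hηV : η ∈ V :=
    (V.valuation_le_one_iff η).mp ((valuation_map_eq_one_iff ι hV' η).mp hη'1).le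
  -- pull the minimal polynomial back along `ι`
  obtain ⟨f, hfh, hfmon, hfL⟩ := exists_map_eq_of_coeff_mem_map ι L hmon fun k => (hcoeff k).2
  have hfV : ∀ k, f.coeff k ∈ V := fun k => by
    rw [← hV', ValuationSubring.mem_comap, ← Polynomial.coeff_map, hfh]
    exact (hcoeff k).1
  have hfev : f.eval η = 0 := by
    rw [← hfh, Polynomial.eval_map, Polynomial.eval₂_hom] at hev
    exact (map_eq_zero ι).mp hev
  have hfder : V.valuation ((derivative f).eval η) = 1 := by
    rw [← hfh, Polynomial.derivative_map, Polynomial.eval_map, Polynomial.eval₂_hom] at hder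
    exact (valuation_map_eq_one_iff ι hV' _).mp hder
  have hgen : Subfield.closure ((L : Set Ω) ∪ {η}) = F := by
    have hmap : (Subfield.closure ((L : Set Ω) ∪ {η})).map ι = F.map ι := by
      rw [map_closure_union, Set.image_singleton, hgen']
    have := congrArg (Subfield.comap ι) hmap
    rwa [Subfield.comap_map, Subfield.comap_map] at this
  exact ⟨x, hxF, hx, η, hηV, f, hgen, hfmon, fun k => ⟨hfV k, hfL k⟩, hfev, hfder⟩

end Literature.AlgebraicGeometry.Resolution

end
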